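import Summits.BirchSwinnertonDyer.Rank1Residual.Additive.RealTwistPeriod
import Summits.BirchSwinnertonDyer.Rank1Residual.Additive.X3RankZeroSemistableTwist
import Summits.BirchSwinnertonDyer.Rank1Residual.Additive.RamifiedTwistMinimality
import HarnessLib

/-!
# X3 ∧ `r_an = 0` ∧ (semistable twist), `p ≡ 1 (mod 4)`, WITHOUT the period named fact: Pal's `d > 0` relation proved, `ord_p #Ш(E) ≤ ord_p #Ш_an(E)` from Delbourgo + the typed input only (cell `b2b-bsdres`, seat additive-p4, line V9)

HONEST FRAMING (cell `b2b-bsdres`, run/shared/lean/b2b/bsd-rank1-residual/, verbatim in every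
file): the goal of the cell is to DELETE the COMBINATION-SHAPED residual classes of the
Birch–Swinnerton-Dyer formula for ALL analytic-rank `≤ 1` elliptic curves over `ℚ` — "full BSD
formula for every rank `≤ 1` curve in class `C`" assembled STRICTLY from published theorems — so
that the rank-`≤ 1` remainder becomes exactly the CONSTRUCTION-SHAPED classes, which are TYPED
(missing-input `Prop`s), NOT attempted. This is not "finishing BSD". The additive sub-cell (seats
additive-p1…p4) is a RESEARCH ROUTE on the construction-shaped classes X3/X4; no claim beyond the
stated classes; the label of X3 is UNCHANGED (its one non-published input is TYPED).

Theorems only (no definition, no named fact). `X3RankZeroSemistableTwist.lean` (p203525) proved the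
even-branch (`p ≡ 1 (mod 4)`) upper bound `ord_p #Ш(E) ≤ ord_p #Ш_an(E)` on X3 ∧ `r_an = 0` ∧
(semistable twist) from Delbourgo 1998 Prop. 4, the typed input [B∘C](0), Gross–Zagier–Kolyvagin,
modularity AND Pal 2012 Thm. 3.2 as a NAMED FACT (`hPal`, p202706: `√p·Ω(W) = Ω(V)`, i.e. Pal's
`ũ = 1`). This file removes that named fact, exactly as the odd file
`X3RankZeroSemistableTwistOdd.lean` (p203966) does for `p ≡ 3 (mod 4)`:

* (from `RealTwistPeriod.lean`) `realPeriodRat_mul_sqrt_of_twist_of_pos` — Pal 2012 Thm. 3.2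
  for `d > 0`, PROVED with the scaling explicit: `Ω(Wd)·√d = |u(C)|·Ω(V)` for `Wd = C • V^{(d)}`;
* `entireLFunction_one_eq_of_twist_explicit` — `L(E,1) = ε·ϖ·(∑(a/p)[a/p]⁺_f)·Ω_E/|u(C)|`, `ε = ±1`
  (Birch + `τ² = p` + the proved period relation; modularity `hmod` only);
* `X3RankZeroTwist.missingUpperBoundAt_factFree` (and `.bsdp_of_shaAn_unit_factFree`,
  `.missingPPartAt_iff_lower_factFree`): on X3 ∧ `r_an = 0` ∧ (`W = C • V^{(p)}`, `V` good
  ordinary or multiplicative at `p`) ∧ `p ≡ 1 (mod 4)`: **`ord_p #Ш(E) ≤ ord_p #Ш_an(E)`** from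
  `hDel` (Delbourgo 1998 Prop. 4, p202678), `hGZK`, `hmod` and the typed `ChiBranchLeadingTermAt W p`
  ALONE — `ord_p u(C) = 0` by `RamifiedTwistMinimality.lean` (p203909: `V^{(p)}` is `p`-minimal),
  `c_p(E) ∈ {1,…,4}` a `p`-unit as `p ≥ 5`.
So for EVERY odd `p` the V9 upper bound now rests on exactly: Delbourgo 1998 Thm. 3/Prop. 4,
Gross–Zagier–Kolyvagin, modularity, and the typed [B∘C](0).

References: Pal 2012 [Pal2012] Thm. 3.2; Delbourgo 1998 [Delbourgo1998] Prop. 4; Miller 2011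
[Miller2011LMS] Def. 1.1; Silverman *AEC* III.1 Table 3.1, X.2.
-/

noncomputable section

open scoped Classical MatrixGroups ModularForm

open CongruenceSubgroup WeierstrassCurve Literature.NumberTheory.EllipticCurves
  Literature.NumberTheory.EllipticCurves.ModularForms
  Literature.NumberTheory.EllipticCurves.Rank1Residual

namespace Summit.BirchSwinnertonDyer.Rank1Residual.Additive

/-! ## The analytic side at `p ≡ 1 (mod 4)` without the period fact -/

section AnalyticExplicit

open Literature.NumberTheory.QuadraticFields Rat.HeightOneSpectrum

variable (p : ℕ) [hp : Fact p.Prime]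

/-- **[E] + [F] + Birch at `p ≡ 1 (mod 4)`, no named period fact**:
`L(E, 1) = ε · ϖ · (∑_{a mod p} (a/p)[a/p]⁺_f) · Ω_E / |u(C)|` with `ε = ±1`, for
`E = W = C • V^{(p)}` additive at `p`, `f` the newform of `V`, `ϖ · Ω_V = Ω⁺_f` — Birch's formula
(tree theorem), `τ(χ_p)² = p`, and the PROVED period relation `Ω(W)·√p = |u(C)|·Ω(V)`
(`realPeriodRat_mul_sqrt_of_twist_of_pos`). Only modularity (`hmod`) is assumed. -/
theorem entireLFunction_one_eq_of_twist_explicit (hmod : hasEntireLFunction_rat) (hp4 : p % 4 = 1)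
    (V W : WeierstrassCurve ℚ) [V.IsElliptic] [V.IsGloballyMinimal] [W.IsElliptic]
    [W.IsGloballyMinimal] (C : VariableChange ℚ) (hC : C • V.quadraticTwist (p : ℚ) = W)
    (hadd : Addv W p) {N : ℕ} [NeZero N] {f : CuspForm (Gamma0 N) 2} (hf : IsNewformOf V f)
    (ϖ : ℚ) (hϖ : (ϖ : ℝ) * V.realPeriodRat = plusPeriod f) :
    ∃ ε : ℚ, (ε = 1 ∨ ε = -1) ∧
      W.entireLFunction 1 =
        ((ε * (ϖ * legendrePlusSymbolSum f p) / |(C.u : ℚ)| : ℚ) : ℂ) * (W.realPeriodRat : ℂ) := by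
  haveI : NeZero p := ⟨hp.out.ne_zero⟩
  have hp2 : p ≠ 2 := by omega
  obtain ⟨hχ1, hχq, hχprim⟩ := jacobiChar_prime_ne_one_isQuadratic_isPrimitive p hp2
  have hχe := jacobiChar_even_of_mod_four_eq_one p hp4
  set χ := jacobiChar p with hχdef
  have hE : W.HasEntireLFunction := hmod W
  have hco : ∀ n : ℕ, ((W.LFunction n : ℤ) : ℂ) = χ n * cuspCoeff f n :=
    fun n ↦ intCast_LFunction_eq_jacobiChar_mul_cuspCoeff p hp4 V W ⟨C, hC⟩ hadd hf n
  have hL' : ∀ s : ℂ, 2 < s.re → W.entireLFunction s = twistedLSeries f χ⁻¹ s := by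
    intro s hs
    rw [hχq.inv, W.entireLFunction_eq_LSeries hE (by linarith), LSeries_eq_twistedLSeries_of_coeff W f χ hco]
  have hB := ratTwistedSymbolSum_mul_plusPeriod_holds hf.1 hf.coeffField_eq_bot hχprim hχe
    (W.differentiable_entireLFunction hE) hL'
  rw [← cast_legendrePlusSymbolSum_eq_ratTwistedSymbolSum p f] at hB
  set τ : ℂ := gaussSum χ (ZMod.stdAddChar (N := p)) with hτdef
  have hτsq : τ ^ 2 = (p : ℂ) := by
    rw [hτdef, gaussSum_sq hχ1 hχq (ZMod.isPrimitive_stdAddChar p), hχe, one_mul, ZMod.card]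
  -- the proved period relation
  have hpal := realPeriodRat_mul_sqrt_of_twist_of_pos V (d := (p : ℚ))
    (by exact_mod_cast hp.out.pos) W C hC
  have hsq : Real.sqrt ((p : ℚ) : ℝ) = Real.sqrt p := by push_cast; rfl
  rw [hsq] at hpal
  set s : ℝ := Real.sqrt p with hs
  set ua : ℝ := |((C.u : ℚ) : ℝ)| with hua
  have hs0 : s ≠ 0 := Real.sqrt_ne_zero'.mpr (by exact_mod_cast hp.out.pos)
  have hsC : ((s : ℝ) : ℂ) ^ 2 = (p : ℂ) := by
    rw [← Complex.ofReal_pow, hs, Real.sq_sqrt (Nat.cast_nonneg p)]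
    push_cast
    rfl
  have hua0 : ua ≠ 0 := by
    rw [hua]
    exact abs_ne_zero.mpr (by exact_mod_cast C.u.ne_zero)
  have hΩV : V.realPeriodRat = W.realPeriodRat * s / ua := by
    rw [eq_div_iff hua0, hpal, mul_comm]
  have hper : (plusPeriod f : ℂ) = (ϖ : ℂ) * (V.realPeriodRat : ℂ) := by
    rw [← Complex.ofReal_ratCast, ← hϖ]
    push_cast
    ring
  rw [hper] at hB
  have hτpm : τ = (s : ℂ) ∨ τ = -(s : ℂ) := by
    have h0 : (τ + (s : ℂ)) * (τ - (s : ℂ)) = 0 := by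
      rw [← sq_sub_sq, hτsq, hsC, sub_self]
    rcases mul_eq_zero.mp h0 with h | h
    · exact Or.inr (eq_neg_of_add_eq_zero_left h)
    · exact Or.inl (sub_eq_zero.mp h)
  have hsC0 : ((s : ℝ) : ℂ) ≠ 0 := by exact_mod_cast hs0
  have huaC0 : ((ua : ℝ) : ℂ) ≠ 0 := by exact_mod_cast hua0
  have hΩVC : (V.realPeriodRat : ℂ) = (W.realPeriodRat : ℂ) * (s : ℂ) / (ua : ℂ) := by
    rw [hΩV]
    push_cast
    ring
  have huacast : ((|(C.u : ℚ)| : ℚ) : ℂ) = (ua : ℂ) := by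
    rw [hua, ← Complex.ofReal_ratCast, Rat.cast_abs]
  rcases hτpm with h | h
  · refine ⟨1, Or.inl rfl, ?_⟩
    rw [h, hΩVC] at hB
    have key : W.entireLFunction 1 * (ua : ℂ) =
        (legendrePlusSymbolSum f p : ℂ) * (ϖ : ℂ) * (W.realPeriodRat : ℂ) := by
      have h1 := hB
      field_simp at h1
      linear_combination -h1
    rw [Rat.cast_div, huacast, div_mul_eq_mul_div, eq_div_iff huaC0]
    push_cast
    linear_combination key
  · refine ⟨-1, Or.inr rfl, ?_⟩
    rw [h, hΩVC] at hB
    have key : W.entireLFunction 1 * (ua : ℂ) =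
        -((legendrePlusSymbolSum f p : ℂ) * (ϖ : ℂ) * (W.realPeriodRat : ℂ)) := by
      have h1 := hB
      field_simp at h1
      linear_combination h1
    rw [Rat.cast_div, huacast, div_mul_eq_mul_div, eq_div_iff huaC0]
    push_cast
    linear_combination key

end AnalyticExplicit

/-! ## The even assembly without the period fact -/

section AssemblyFactFree

open IsDedekindDomain NumberField Rat.HeightOneSpectrum
  Literature.NumberTheory.EllipticCurves.Rank1Residual.Typed

variable (W : WeierstrassCurve ℚ) [W.IsElliptic] [W.IsGloballyMinimal] (p : ℕ) [hp : Fact p.Prime]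

/-- **Core theorem (line V9, rank 0, `p ≡ 1 (mod 4)`), without the period named fact.** As
`X3RankZeroTwist.missingUpperBoundAt_of_leadingTerm` (p203525) but with Pal's `√p·Ω(W) = Ω(V)`
(`hPal`) replaced by the PROVED relation `Ω(W)·√p = |u(C)|·Ω(V)` and `ord_p u(C) = 0`
(`RamifiedTwistMinimality.lean`): for `E = W = C • V^{(p)}` in class X3 of analytic rank `0`, `V`
good ordinary or multiplicative at `p`, `f` the newform of `V`, `ϖ·Ω_V = Ω⁺_f`, and the pointwise
[B∘C](0) statement `hLT`: **`ord_p #Ш(E) ≤ ord_p #Ш_an(E)`** from Delbourgo 1998 Prop. 4 (`hDel`),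
Gross–Zagier–Kolyvagin (`hGZK`) and modularity (`hmod`) only. -/
theorem X3RankZeroTwist.missingUpperBoundAt_of_leadingTerm_factFree
    (hDel : Delbourgo1998.prop4_rankZero_pow_dvd_constantCoeff)
    (hGZK : rank_eq_analyticRank_of_analyticRank_le_one) (hmod : hasEntireLFunction_rat)
    (hp4 : p % 4 = 1) (hr : W.analyticRank = 0) (hX : ClassX3 W p)
    (V : WeierstrassCurve ℚ) [V.IsElliptic] [V.IsGloballyMinimal]
    (C : VariableChange ℚ) (hC : C • V.quadraticTwist (p : ℚ) = W) (hV : GoodOrd V p ∨ Mult V p)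
    {N : ℕ} [NeZero N] {f : CuspForm (Gamma0 N) 2} (hf : IsNewformOf V f)
    (ϖ : ℚ) (hϖ : (ϖ : ℝ) * V.realPeriodRat = plusPeriod f)
    (hLT : ∀ (κ : ZpExtension ℚ p) (γ : Field.absoluteGaloisGroup ℚ),
      κ.IsCyclotomic → κ.IsTopGenerator γ → IsCyclotomicVariable p γ →
      ∀ D : W.SelmerDualData κ γ, ∃ g ∈ D.charIdeal, ∃ u : ℤ_[p]ˣ,
        ((PowerSeries.constantCoeff g : ℤ_[p]) : ℚ_[p]) =
          ((u : ℤ_[p]) : ℚ_[p]) * (ϖ : ℚ_[p]) * (legendrePlusSymbolSum f p : ℚ_[p])) :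
    MissingUpperBoundAt W p := by
  classical
  have hpP : p.Prime := hp.out
  have hp2 : p ≠ 2 := by omega
  have hp5 : 5 ≤ p := five_le_of_prime_of_mod_four_eq_one p hp4 hpP
  set v₀ : HeightOneSpectrum (𝓞 ℚ) := (primesEquiv (R := 𝓞 ℚ)).symm ⟨p, hp.out⟩ with hv₀
  -- `ord_p u(C) = 0` (the twisted model is `p`-minimal)
  have hC' : C • V.quadraticTwist (((p : ℤ)) : ℚ) = W := by push_cast; exact hC
  have hu : padicValRat p (C.u : ℚ) = 0 :=
    padicValRat_u_eq_zero_of_twist_pm_p p hp2 V W (hV.elim (fun h ↦ Or.inl h.1) Or.inr)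
      (Or.inl rfl) C hC'
  -- rank 0: `L(E,1) ≠ 0`, `E(ℚ)` and `Ш` finite
  have hL : W.entireLFunction 1 ≠ 0 := (W.analyticRank_eq_zero_iff_holds (hmod W)).mp hr
  obtain ⟨hmw, hfin⟩ := hGZK W (by rw [hr]; exact zero_le_one)
  have hmw0 : W.mordellWeilRank = 0 := by rw [hmw, hr]
  haveI : Finite W.sha := hfin
  haveI hE : Finite W.toAffine.Point := W.finite_point_of_rank_zero hmw0
  -- the cyclotomic setting and `X(E/ℚ_∞)`
  obtain ⟨κ, hκ, γ, hγ, hγ'⟩ := exists_isCyclotomic_isTopGenerator_isCyclotomicVariable_holds p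
  obtain ⟨D⟩ := W.nonempty_selmerDualData_holds κ γ hγ
  obtain ⟨g, hgmem, u, hg0⟩ := hLT κ γ hκ hγ hγ' D
  -- [A]: Delbourgo 1998 Prop. 4
  have hGM := typeGOrd_or_padicValRat_j_neg_of_twist W p hp4 V ⟨C, hC⟩ hV
  obtain ⟨-, hdiv⟩ := hDel W p hp2 hX.2 hGM hr hfin hE κ γ hκ hγ D
  have hdvd := hdiv g hgmem
  -- analytic side (no period fact)
  obtain ⟨ε, hε, hLq⟩ := entireLFunction_one_eq_of_twist_explicit p hmod hp4 V W C hC hX.2 hf ϖ hϖ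
  set S : ℚ := legendrePlusSymbolSum f p with hS
  set q : ℚ := ε * (ϖ * S) / |(C.u : ℚ)| with hq
  have hΩ : (W.realPeriodRat : ℂ) ≠ 0 := by exact_mod_cast W.realPeriodRat_pos_holds.ne'
  have hq' : W.entireLFunction 1 / (W.realPeriodRat : ℂ) = (q : ℂ) := by
    rw [hLq, mul_div_cancel_right₀ _ hΩ]
  obtain ⟨-, -, -, hshaAn⟩ := Wuthrich2014.shaAn_eq_of_L_one_div_eq hGZK W hL hq'
  -- non-vanishing and the valuation of `q`
  have hua0 : |(C.u : ℚ)| ≠ 0 := abs_ne_zero.mpr C.u.ne_zero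
  have hϖS : ϖ * S ≠ 0 := by
    intro h0
    apply hL
    rw [hLq, hq, h0, mul_zero, zero_div, Rat.cast_zero, zero_mul]
  have hε0 : ε ≠ 0 := by rcases hε with h | h <;> rw [h] <;> norm_num
  have hq0 : q ≠ 0 := by
    rw [hq]
    exact div_ne_zero (mul_ne_zero hε0 hϖS) hua0
  have hvε : padicValRat p ε = 0 := by
    rcases hε with h | h
    · rw [h, padicValRat.one]
    · rw [h, padicValRat.neg, padicValRat.one]
  have hvua : padicValRat p |(C.u : ℚ)| = 0 := by
    rcases abs_choice (C.u : ℚ) with h | h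
    · rw [h, hu]
    · rw [h, padicValRat.neg, hu]
  have hvq : padicValRat p q = padicValRat p (ϖ * S) := by
    rw [hq, padicValRat.div (mul_ne_zero hε0 hϖS) hua0, padicValRat.mul hε0 hϖS, hvε, hvua]
    ring
  -- names for the arithmetic quantities
  set T : ℕ := Nat.card W.toAffine.Point with hT
  set c : ℕ := W.tamagawaNumberAt v₀ with hc
  set P' : ℕ := ∏ᶠ v : HeightOneSpectrum (𝓞 ℚ),
    (if (p : 𝓞 ℚ) ∈ v.asIdeal then 1 else W.tamagawaNumberAt v) with hP'
  have hT0 : T ≠ 0 := by rw [hT]; exact Nat.card_pos.ne'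
  have hPsplit : W.tamagawaProduct = c * P' := tamagawaProduct_eq_tamagawaNumberAt_mul_finprod W p
  have hPpos : 0 < W.tamagawaProduct := W.tamagawaProduct_pos_holds
  have hc0 : c ≠ 0 := fun h ↦ by rw [hPsplit, h, zero_mul] at hPpos; exact lt_irrefl 0 hPpos
  have hP'0 : P' ≠ 0 := fun h ↦ by rw [hPsplit, h, mul_zero] at hPpos; exact lt_irrefl 0 hPpos
  have hvc : padicValNat p c = 0 := padicValNat_tamagawaNumberAt_eq_zero_of_addv W p hX.2 hp5
  have hvP : padicValNat p W.tamagawaProduct = padicValNat p P' := by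
    rw [hPsplit, padicValNat.mul hc0 hP'0, hvc, zero_add]
  have hsha : padicValNat p (Nat.card (AddCommGroup.primaryComponent W.sha p)) =
      padicValNat p W.shaOrder := by
    unfold WeierstrassCurve.shaOrder
    exact padicValNat_card_addPrimaryComponent p
  -- the divisibility in `ℤ_p`, read as an inequality of valuations in `ℚ_p`
  set g0 : ℚ_[p] := ((PowerSeries.constantCoeff g : ℤ_[p]) : ℚ_[p]) with hg0def
  have hg0S : g0 = ((u : ℤ_[p]) : ℚ_[p]) * ((ϖ * S : ℚ) : ℚ_[p]) := by
    rw [hg0]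
    push_cast
    ring
  have hϖSQ : ((ϖ * S : ℚ) : ℚ_[p]) ≠ 0 := by exact_mod_cast hϖS
  have hg0ne : g0 ≠ 0 := by
    rw [hg0S]
    exact mul_ne_zero (coe_units_ne_zero p u) hϖSQ
  have hvg0 : g0.valuation = padicValRat p (ϖ * S) := by
    rw [hg0S, Padic.valuation_mul (coe_units_ne_zero p u) hϖSQ, valuation_coe_units_eq_zero,
      zero_add, Padic.valuation_ratCast]
  have hTQ : ((T : ℕ) : ℚ_[p]) ≠ 0 := by exact_mod_cast hT0
  obtain ⟨c', hc'⟩ := hdvd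
  have hkey : g0 * ((T : ℕ) : ℚ_[p]) ^ 2 =
      (p : ℚ_[p]) ^ (padicValNat p (Nat.card (AddCommGroup.primaryComponent W.sha p)) +
        padicValNat p P') * ((c' : ℤ_[p]) : ℚ_[p]) := by
    have h := congrArg ((↑) : ℤ_[p] → ℚ_[p]) hc'
    push_cast at h
    rw [hg0def]
    exact h
  have hlhs0 : g0 * ((T : ℕ) : ℚ_[p]) ^ 2 ≠ 0 := mul_ne_zero hg0ne (pow_ne_zero 2 hTQ)
  have hc'0 : ((c' : ℤ_[p]) : ℚ_[p]) ≠ 0 := by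
    intro h0
    rw [h0, mul_zero] at hkey
    exact hlhs0 hkey
  have hpQ : (p : ℚ_[p]) ≠ 0 := by exact_mod_cast hpP.ne_zero
  have hval := congrArg Padic.valuation hkey
  rw [Padic.valuation_mul hg0ne (pow_ne_zero 2 hTQ), Padic.valuation_pow, Padic.valuation_natCast,
    hvg0, Padic.valuation_mul (pow_ne_zero _ hpQ) hc'0, Padic.valuation_pow, Padic.valuation_p,
    mul_one, hsha] at hval
  have hc'val : 0 ≤ (((c' : ℤ_[p]) : ℚ_[p])).valuation := PadicInt.valuation_coe_nonneg
  have hineq : (padicValNat p W.shaOrder : ℤ) + padicValNat p P' ≤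
      padicValRat p (ϖ * S) + 2 * (padicValNat p T : ℤ) := by
    simp only [Nat.cast_add, Nat.cast_ofNat] at hval
    linarith
  -- conclusion
  refine ⟨q * (T : ℚ) ^ 2 / (W.tamagawaProduct : ℚ), ?_, ?_⟩
  · rw [hshaAn]
  · have hTq : (T : ℚ) ≠ 0 := by exact_mod_cast hT0
    have hPq : (W.tamagawaProduct : ℚ) ≠ 0 := by exact_mod_cast hPpos.ne'
    rw [padicValRat.div (mul_ne_zero hq0 (pow_ne_zero 2 hTq)) hPq,
      padicValRat.mul hq0 (pow_ne_zero 2 hTq), padicValRat.pow, padicValRat.of_nat,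
      padicValRat.of_nat, hvq, hvP]
    simp only [Nat.cast_ofNat]
    linarith

/-- **X3 ∧ `r_an = 0` ∧ (semistable twist), `p ≡ 1 (mod 4)`: `ord_p #Ш(E) ≤ ord_p #Ш_an(E)` from
Delbourgo 1998 Prop. 4 (`hDel`), Gross–Zagier–Kolyvagin (`hGZK`), modularity (`hmod`) and the typed
input `ChiBranchLeadingTermAt W p` ONLY** (no period fact; compare `X3RankZeroTwist.missingUpperBoundAt`,
p203525, which also took Pal's fact p202706). -/
theorem X3RankZeroTwist.missingUpperBoundAt_factFree
    (hDel : Delbourgo1998.prop4_rankZero_pow_dvd_constantCoeff)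
    (hGZK : rank_eq_analyticRank_of_analyticRank_le_one) (hmod : hasEntireLFunction_rat)
    (hBC : ChiBranchLeadingTermAt W p)
    (hp4 : p % 4 = 1) (hr : W.analyticRank = 0) (hX : ClassX3 W p)
    (V : WeierstrassCurve ℚ) [V.IsElliptic] [V.IsGloballyMinimal]
    (C : VariableChange ℚ) (hC : C • V.quadraticTwist (p : ℚ) = W) (hV : GoodOrd V p ∨ Mult V p)
    {N : ℕ} [NeZero N] {f : CuspForm (Gamma0 N) 2} (hf : IsNewformOf V f)
    (ϖ : ℚ) (hϖ : (ϖ : ℝ) * V.realPeriodRat = plusPeriod f) :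
    MissingUpperBoundAt W p :=
  X3RankZeroTwist.missingUpperBoundAt_of_leadingTerm_factFree W p hDel hGZK hmod hp4 hr hX V C hC hV
    hf ϖ hϖ fun _ _ hκ hγ hγ' D ↦ (hBC V hp4 ⟨C, hC⟩ hV hX.1 hκ hγ hγ' hf D ϖ hϖ).2

/-- **`BSD(E,p)` on the `p`-unit rows, `p ≡ 1 (mod 4)`, no period fact**: granted [B∘C](0), if
`#Ш_an(E)` is a `p`-adic unit then Miller's `BSD(E,p)` holds. -/
theorem X3RankZeroTwist.bsdp_of_shaAn_unit_factFree
    (hDel : Delbourgo1998.prop4_rankZero_pow_dvd_constantCoeff)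
    (hGZK : rank_eq_analyticRank_of_analyticRank_le_one) (hmod : hasEntireLFunction_rat)
    (hBC : ChiBranchLeadingTermAt W p)
    (hp4 : p % 4 = 1) (hr : W.analyticRank = 0) (hX : ClassX3 W p)
    (V : WeierstrassCurve ℚ) [V.IsElliptic] [V.IsGloballyMinimal]
    (C : VariableChange ℚ) (hC : C • V.quadraticTwist (p : ℚ) = W) (hV : GoodOrd V p ∨ Mult V p)
    {N : ℕ} [NeZero N] {f : CuspForm (Gamma0 N) 2} (hf : IsNewformOf V f)
    (ϖ : ℚ) (hϖ : (ϖ : ℝ) * V.realPeriodRat = plusPeriod f)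
    {q : ℚ} (hq : shaAn W = (q : ℂ)) (hv : padicValRat p q = 0) : BSDp W p :=
  bsdp_of_missingPPartAt W p hGZK (by rw [hr]; exact zero_le_one)
    (missingPPartAt_of_upper_of_shaAn_unit W p
      (X3RankZeroTwist.missingUpperBoundAt_factFree W p hDel hGZK hmod hBC hp4 hr hX V C hC hV hf ϖ hϖ)
      hq hv)

/-- **What remains of X3♯ on these pairs is the LOWER half** (`p ≡ 1 (mod 4)`, no period fact):
`Typed.X3.MissingInputAt W p ⟺ MissingLowerBoundAt W p`, granted [B∘C](0). -/
theorem X3RankZeroTwist.missingPPartAt_iff_lower_factFree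
    (hDel : Delbourgo1998.prop4_rankZero_pow_dvd_constantCoeff)
    (hGZK : rank_eq_analyticRank_of_analyticRank_le_one) (hmod : hasEntireLFunction_rat)
    (hBC : ChiBranchLeadingTermAt W p)
    (hp4 : p % 4 = 1) (hr : W.analyticRank = 0) (hX : ClassX3 W p)
    (V : WeierstrassCurve ℚ) [V.IsElliptic] [V.IsGloballyMinimal]
    (C : VariableChange ℚ) (hC : C • V.quadraticTwist (p : ℚ) = W) (hV : GoodOrd V p ∨ Mult V p)
    {N : ℕ} [NeZero N] {f : CuspForm (Gamma0 N) 2} (hf : IsNewformOf V f)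
    (ϖ : ℚ) (hϖ : (ϖ : ℝ) * V.realPeriodRat = plusPeriod f) :
    X3.MissingInputAt W p ↔ MissingLowerBoundAt W p :=
  ⟨fun h ↦ (lower_and_upper_of_missingPPartAt W p h).1, fun h ↦
    missingPPartAt_of_lower_of_upper W p h
      (X3RankZeroTwist.missingUpperBoundAt_factFree W p hDel hGZK hmod hBC hp4 hr hX V C hC hV hf ϖ
        hϖ)⟩

end AssemblyFactFree

end Summit.BirchSwinnertonDyer.Rank1Residual.Additive

end
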